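import Summits.ResolutionOfSingularities.ResolutionOfSingularities.Theorems.HilbertSamuelEliminationSigmaMaxModificationsCorridor3SigmaTameLowSncBranchDelta
import Summits.ResolutionOfSingularities.ResolutionOfSingularities.Theorems.HilbertSamuelEliminationSigmaMaxModificationsCorridor3SigmaTameLowSncDefect
import HarnessLib

/-!
# [OURS · L1 W4.2] TAME-LOW row T-L4 «SNC PHASE, lineage-local» — part 4d (singular-branch half): THE BRANCH LINEAGE THEOREM — along a
# lineage of point blow-ups, the strict transforms `fₙ₊₁ = fₙ / xₙ^{ord fₙ}` of a branch with module-finite normalisation are, from some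
# stage on, units (the branch has left the lineage point) or REGULAR PARAMETERS (the entry hypothesis of part 3)
# (cell res-hironaka, LADDER-RESOLUTION rung L; slot W4.2, crux chain w42 `SigmaMaxModificationsCorridor3` stmt-ResolutionOfSingularities-19249 /
# crux `SigmaMaxModifications` stmt-…-18506; res-L1-w42-plan-1 RULING v3.14-48 (PD)(iv)/(PF) row T-L4 → res-L1-w42-stub-4 (gen 7);
# `--supports stmt-ResolutionOfSingularities-19249 --as helper`; consumers: res-D-pv-002 ((TL6) fuel, first `δ` coordinate), res-L1-type-o1/o2
# (TAME-LOW prescription / readings), part 3 `eventually_sncAt_of_lineage` (entry stage))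

HONEST FRAMING.  OURS bookkeeping for the TAME-LOW tier (RULING v3.14-48 (PD)(iv)): Kollár 2007 Thm. 1.101 / Krull 1930 for ONE branch
followed along a lineage of point blow-ups of the ambient two-dimensional regular local rings, assembled from part 4c (the strict transform at
the next point is a quadratic transform of the branch; `δ` drops while singular; a branch with regular local ring is a regular parameter).
Nothing here is a statement of H. Hironaka's manuscript [Hironaka2017] (CANDIDATE, never a premise) nor of Cossart–Jannsen–Saito; no named fact;
def-free; every theorem PROVED. AI-written; weaker than expert review.

THE DATA.  A lineage `R : ℕ → Subring K` of two-dimensional regular local rings, `R (n+1)` a quadratic transform of `R n` in the chart of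
`x n ∈ 𝔪_{R n} ∖ 0`; a branch `f 0 ∈ 𝔪_{R 0} ∖ 0` with a point `θ₀ : R 0 → L`, `ker θ₀ = (f 0)`, whose local ring `θ₀(R 0) ≅ R 0/(f 0)` is a
local ring OF `L` (`L = Frac`) with module-finite normalisation (excellence of the ambient scheme supplies this); its strict transforms
`f (n+1) = f n / (x n)^{ord (f n)}` with `ord g = contactOrder 0 g = sup {k | g ∈ 𝔪ᵏ}` (once `f n` is a unit, `ord = 0` and `f` is frozen).

* `contactOrder_zero_iff`, `contactOrder_zero_ne_top` — `ord` via part 1a's `contactOrder 0`; finiteness for `g ≠ 0` (Krull);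
  `contactOrder_ne_top_of_not_dvd` — non-associated branches have finite contact (the distinctness hypothesis of parts 2–3).
* `not_dvd_strictTransform` — `f ∤ g ⇒ f/xᵐ ∤ g/xᵏ` in `R₁`: distinct branches stay distinct along the lineage.
* **`exists_not_mem_or_isRegularBranch_of_branchLineage`** — **some strict transform `f N` is a unit of `R N` or a regular parameter of
  `R N`**: otherwise every `f n ∈ 𝔪²_{R n}`, the points `θₙ : R n → L` propagate by part 4b's `branchLift` with `ker θₙ = (f n)`, each
  `θₙ₊₁(R (n+1))` is a quadratic transform of the non-regular germ `θₙ(R n)` (part 4c), and `δ` would descend for ever in `ℕ`.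

References: J. Kollár (2007), §1.4, Thm. 1.101 [Kollar2007]; M. Herrmann, S. Ikeda, U. Orbanz (1988), Thm. (30.2) [HerrmannIkedaOrbanz1988].
-/

noncomputable section

set_option linter.dupNamespace false -- mandated namespace of this single-conjunct summit

open IsLocalRing Literature.AlgebraicGeometry.Resolution

namespace Summit.ResolutionOfSingularities.ResolutionOfSingularities.Theorems.SigmaMaxModificationsCorridor3.TameLowSnc

universe u v

variable {K : Type u} [Field K]

/-! ## §1 The order `contactOrder 0 g = sup {k | g ∈ 𝔪ᵏ}` -/

section Order

variable {A : Type u} [CommRing A] [IsLocalRing A]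

/-- `contactOrder 0 g = m ↔ g ∈ 𝔪ᵐ ∧ g ∉ 𝔪ᵐ⁺¹`. [OURS · proved] -/
theorem contactOrder_zero_iff (g : A) (m : ℕ) :
    contactOrder (0 : A) g = m ↔ g ∈ maximalIdeal A ^ m ∧ g ∉ maximalIdeal A ^ (m + 1) := by
  rw [contactOrder_eq_coe_iff, Ideal.span_singleton_eq_bot.mpr rfl, bot_sup_eq, bot_sup_eq]

/-- `contactOrder 0 g < ⊤` for `g ≠ 0` in a Noetherian local ring (Krull's intersection theorem). [OURS · proved] -/
theorem contactOrder_zero_ne_top [IsNoetherianRing A] {g : A} (hg : g ≠ 0) : contactOrder (0 : A) g ≠ ⊤ := by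
  intro h
  rw [contactOrder_eq_top_iff] at h
  apply hg
  have hmem : g ∈ ⨅ k : ℕ, maximalIdeal A ^ k := by
    refine Ideal.mem_iInf.mpr fun k => ?_
    have := h k
    rwa [Ideal.span_singleton_eq_bot.mpr rfl, bot_sup_eq] at this
  rwa [Ideal.iInf_pow_eq_bot_of_isLocalRing _ (maximalIdeal.isMaximal A).ne_top, Ideal.mem_bot] at hmem

/-- **Distinct branches have finite contact**: in a Noetherian local ring, `f ∈ 𝔪` and `f ∤ g` give `contactOrder f g < ⊤` (Krull's
intersection theorem in `A/(f)`) — the distinctness hypothesis of parts 2–3 for non-associated branches. [OURS · proved] -/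
theorem contactOrder_ne_top_of_not_dvd [IsNoetherianRing A] {f g : A} (hf : f ∈ maximalIdeal A) (hfg : ¬ f ∣ g) :
    contactOrder f g ≠ ⊤ := by
  intro h
  rw [contactOrder_eq_top_iff] at h
  apply hfg
  have hne : Ideal.span {f} ≠ ⊤ := fun htop =>
    (maximalIdeal.isMaximal A).ne_top (top_le_iff.mp (htop ▸ (Ideal.span_singleton_le_iff_mem _).mpr hf))
  haveI : Nontrivial (A ⧸ Ideal.span {f}) := Ideal.Quotient.nontrivial_iff.mpr hne
  haveI : IsLocalRing (A ⧸ Ideal.span {f}) :=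
    IsLocalRing.of_surjective' (Ideal.Quotient.mk _) Ideal.Quotient.mk_surjective
  have hmap : (maximalIdeal A).map (Ideal.Quotient.mk (Ideal.span {f})) = maximalIdeal (A ⧸ Ideal.span {f}) :=
    IsLocalRing.map_maximalIdeal_of_surjective _ Ideal.Quotient.mk_surjective
  have hmem : Ideal.Quotient.mk (Ideal.span {f}) g ∈ ⨅ k : ℕ, maximalIdeal (A ⧸ Ideal.span {f}) ^ k := by
    refine Ideal.mem_iInf.mpr fun k => ?_
    have hk : Ideal.Quotient.mk (Ideal.span {f}) g ∈ (Ideal.span {f} ⊔ maximalIdeal A ^ k).map (Ideal.Quotient.mk _) :=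
      Ideal.mem_map_of_mem _ (h k)
    rw [Ideal.map_sup, Ideal.map_pow, hmap, Ideal.map_quotient_self, bot_sup_eq] at hk
    exact hk
  rw [Ideal.iInf_pow_eq_bot_of_isLocalRing _ (maximalIdeal.isMaximal _).ne_top, Ideal.mem_bot,
    Ideal.Quotient.eq_zero_iff_mem, Ideal.mem_span_singleton] at hmem
  exact hmem

end Order

section Distinct

variable {R R₁ : Subring K} [IsRegularLocalRing R] [IsLocalRing R₁] {x y : R} {L : Type v} [Field L]

/-- **Distinct branches stay distinct**: with the data of part 4b (`ψ = branchLift …`, `ker ψ = (f/xᵐ) R₁`), if `f ∤ g` in `R` then the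
strict transform `f/xᵐ` does not divide ANY `g/xᵏ ∈ R₁` in `R₁` (apply `ψ`: `ψ(g/xᵏ) · θ(x)ᵏ = θ g ≠ 0`). So non-associated branches have
non-associated strict transforms, and `contactOrder_ne_top_of_not_dvd` keeps supplying the distinctness hypothesis of parts 2–3 along the
lineage. [OURS · proved] -/
theorem not_dvd_strictTransform (hdim : ringKrullDim R = 2) (hm : maximalIdeal R = Ideal.span {x, y})
    (hq : IsQuadraticTransform R R₁) (hT : blowupRing R (x : K) ≤ R₁) (θ : R →+* L) (hθx : θ x ≠ 0) {f : R}
    (hker : RingHom.ker θ = Ideal.span {f}) {m : ℕ} (hf : f ∈ maximalIdeal R ^ m) (hf' : f ∉ maximalIdeal R ^ (m + 1))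
    (hf₁ : (⟨_, chartAdjoin_le hm hT (div_pow_mem_chartAdjoin hm
      (fun h => fst_not_mem_sq hdim hm (h ▸ Ideal.zero_mem _)) hf)⟩ : R₁) ∈ maximalIdeal R₁)
    {g : R} (hfg : ¬ f ∣ g) {k : ℕ} (hgk : ((g : R) : K) / ((x : R) : K) ^ k ∈ R₁) :
    ¬ (⟨_, chartAdjoin_le hm hT (div_pow_mem_chartAdjoin hm
      (fun h => fst_not_mem_sq hdim hm (h ▸ Ideal.zero_mem _)) hf)⟩ : R₁) ∣ ⟨_, hgk⟩ := by
  have hx0 : x ≠ 0 := fun h => fst_not_mem_sq hdim hm (h ▸ Ideal.zero_mem _)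
  have hx0K : ((x : R) : K) ≠ 0 := fun e => hx0 (Subtype.ext e)
  set ψ := branchLift hdim hm hq hT θ hθx hker hf hf' hf₁ with hψ
  rintro ⟨c, hc⟩
  -- `ψ (g/xᵏ) = 0`
  have h0 : ψ ⟨_, hgk⟩ = 0 := by
    have hmem : (⟨_, hgk⟩ : R₁) ∈ RingHom.ker ψ := by
      rw [hψ, ker_branchLift, hc]; exact Ideal.mul_mem_right _ _ (Ideal.mem_span_singleton_self _)
    exact hmem
  -- but `ψ (g/xᵏ) · θ x ^ k = θ g ≠ 0`
  have h1 : ψ ⟨_, hgk⟩ * θ x ^ k = θ g := by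
    rw [← branchLift_inclusion hdim hm hq hT θ hθx hker hf hf' hf₁ x,
      ← branchLift_inclusion hdim hm hq hT θ hθx hker hf hf' hf₁ g, ← hψ, ← map_pow, ← map_mul]
    congr 1
    apply Subtype.ext
    change ((g : R) : K) / ((x : R) : K) ^ k * ((x : R) : K) ^ k = (g : K)
    rw [div_mul_cancel₀ _ (pow_ne_zero _ hx0K)]
  rw [h0, zero_mul] at h1
  have hg : g ∈ RingHom.ker θ := by rw [RingHom.mem_ker, ← h1]
  rw [hker, Ideal.mem_span_singleton] at hg
  exact hfg hg

end Distinct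

/-! ## §2 The branch lineage theorem -/

section BranchLineage

variable {L : Type v} [Field L]

/-- **THE BRANCH LINEAGE THEOREM (singular-branch half of the snc phase).**  Along a lineage `R 0 → R 1 → ⋯` of point blow-ups through
two-dimensional regular local rings of `K` (chart elements `x n`), the strict transforms `f (n+1) = f n / (x n)^{ord f n}` of a branch
`f 0` whose local ring `θ₀(R 0) ≅ R 0/(f 0)` is a local ring of `L` with module-finite normalisation reach a stage `N` at which `f N` is a
UNIT of `R N` (the branch no longer passes through the lineage point) or a REGULAR PARAMETER of `R N`. [OURS · proved; Kollár 2007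
Thm. 1.101 along a lineage, via parts 4a–4c] -/
theorem exists_not_mem_or_isRegularBranch_of_branchLineage
    (R : ℕ → Subring K) (hreg : ∀ n, IsRegularLocalRing (R n)) (hdim : ∀ n, ringKrullDim (R n) = 2)
    (hq : ∀ n, IsQuadraticTransform (R n) (R (n + 1)))
    (x : ℕ → K) (hx : ∀ n, x n ∈ R n) (hxm : ∀ n, (⟨x n, hx n⟩ : R n) ∈ maximalIdeal (R n)) (hx0 : ∀ n, x n ≠ 0)
    (hT : ∀ n, blowupRing (R n) (x n) ≤ R (n + 1))
    (f : ℕ → K) (hf : ∀ n, f n ∈ R n) (hf00 : f 0 ≠ 0)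
    (hstep : ∀ n, f (n + 1) = f n / x n ^ (contactOrder (0 : R n) ⟨f n, hf n⟩).toNat)
    (θ₀ : R 0 →+* L) (hker₀ : RingHom.ker θ₀ = Ideal.span {⟨f 0, hf 0⟩})
    (hof₀ : IsLocalRingOf θ₀.range) (hfin₀ : Module.Finite θ₀.range (integralClosure θ₀.range L)) :
    ∃ N, (⟨f N, hf N⟩ : R N) ∉ maximalIdeal (R N) ∨ IsRegularBranch (R N) (f N) := by
  by_contra H
  push Not at H
  -- every strict transform is in `𝔪²`
  have hsq : ∀ n, (⟨f n, hf n⟩ : R n) ∈ maximalIdeal (R n) ^ 2 := by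
    intro n
    haveI := hreg n
    obtain ⟨hmem, hnot⟩ := H n
    by_contra h2
    exact hnot ⟨hf n, hmem, h2⟩
  -- `f n ≠ 0`, by induction
  have hf0 : ∀ n, f n ≠ 0 := by
    intro n
    induction n with
    | zero => exact hf00
    | succ n ih => rw [hstep n]; exact div_ne_zero ih (pow_ne_zero _ (hx0 n))
  -- the descending family of points of the branch
  have key : ∀ n : ℕ, ∃ θ : R n →+* L, RingHom.ker θ = Ideal.span {⟨f n, hf n⟩} ∧ IsLocalRingOf θ.range ∧
      Module.Finite θ.range (integralClosure θ.range L) ∧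
      (curveDelta θ.range L).toNat + n ≤ (curveDelta θ₀.range L).toNat := by
    intro n
    induction n with
    | zero => exact ⟨θ₀, hker₀, hof₀, hfin₀, by omega⟩
    | succ n ih =>
      obtain ⟨θ, hker, hof, hfin, hδ⟩ := ih
      haveI := hreg n
      haveI := hreg (n + 1)
      have hx0' : (⟨x n, hx n⟩ : R n) ≠ 0 := fun h => hx0 n (congrArg Subtype.val h)
      have hx2 : (⟨x n, hx n⟩ : R n) ∉ maximalIdeal (R n) ^ 2 :=
        IsQuadraticTransform.chart_not_mem_sq (hT n) (hq n).dominates hx0'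
      obtain ⟨y, hm, -, -⟩ := exists_maximalIdeal_eq_span_pair_of_not_mem_sq (hdim n) (hxm n) hx2
      -- the order `m` of `f n`
      have hfn0 : (⟨f n, hf n⟩ : R n) ≠ 0 := fun h => hf0 n (congrArg Subtype.val h)
      obtain ⟨m, hmo⟩ := ENat.ne_top_iff_exists.mp (contactOrder_zero_ne_top hfn0)
      obtain ⟨hfm', hfm1⟩ := (contactOrder_zero_iff _ m).mp hmo.symm
      have hfmem : (⟨f n, hf n⟩ : R n) ∈ maximalIdeal (R n) :=
        Ideal.pow_le_self two_ne_zero (hsq n)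
      -- `θ (x n) ≠ 0`: else `f n ∣ x n` and `x n ∈ 𝔪²`
      have hθx : θ ⟨x n, hx n⟩ ≠ 0 := by
        intro h0
        have hxker : (⟨x n, hx n⟩ : R n) ∈ RingHom.ker θ := h0
        rw [hker, Ideal.mem_span_singleton'] at hxker
        obtain ⟨c, hc⟩ := hxker
        apply hx2
        rw [← hc]
        exact Ideal.mul_mem_left _ _ (hsq n)
      -- the strict transform passes through `R (n+1)`: it is `f (n+1) ∈ 𝔪²`
      have hst : f n / x n ^ m = f (n + 1) := by rw [hstep n, ← hmo, ENat.toNat_coe]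
      have hf₁mem : f n / x n ^ m ∈ R (n + 1) := hst ▸ hf (n + 1)
      have hf₁ : (⟨f n / x n ^ m, hf₁mem⟩ : R (n + 1)) ∈ maximalIdeal (R (n + 1)) := by
        have e : (⟨f n / x n ^ m, hf₁mem⟩ : R (n + 1)) = ⟨f (n + 1), hf (n + 1)⟩ := Subtype.ext hst
        rw [e]; exact Ideal.pow_le_self two_ne_zero (hsq (n + 1))
      -- the next point `ψ`
      let ψ := branchLift (hdim n) hm (hq n) (hT n) θ hθx hker hfm' hfm1 hf₁
      have hkerψ : RingHom.ker ψ = Ideal.span {⟨f (n + 1), hf (n + 1)⟩} := by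
        have h := ker_branchLift (hdim n) hm (hq n) (hT n) θ hθx hker hfm' hfm1 hf₁
        have e : (⟨f n / x n ^ m, hf₁mem⟩ : R (n + 1)) = ⟨f (n + 1), hf (n + 1)⟩ := Subtype.ext hst
        rw [← e]; exact h
      obtain ⟨hofψ, -, -, hfinψ⟩ :
          IsLocalRingOf ψ.range ∧ IsNoetherianRing ψ.range ∧ ringKrullDim ψ.range = 1 ∧
            Module.Finite ψ.range (integralClosure ψ.range L) :=
        curveGerm_range_branchLift (hdim n) hm (hq n) (hT n) θ hθx hker hfm' hfm1 hfmem hf₁ hof hfin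
      -- `θ(R n)` is not regular, since `f n ∈ 𝔪²`
      have hsing : ¬ (haveI := isLocalRing_range θ; IsDiscreteValuationRing θ.range) := fun hDVR =>
        not_mem_sq_of_isDiscreteValuationRing_range (hdim n) θ hker hfmem hDVR (hsq n)
      have hlt : (curveDelta ψ.range L).toNat < (curveDelta θ.range L).toNat :=
        toNat_curveDelta_range_branchLift_lt (hdim n) hm (hq n) (hT n) θ hθx hker hfm' hfm1 hfmem hf₁ hof hfin hsing
      exact ⟨ψ, hkerψ, hofψ, hfinψ, by omega⟩
  obtain ⟨θ, -, -, -, hδ⟩ := key ((curveDelta θ₀.range L).toNat + 1)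
  omega

end BranchLineage

end Summit.ResolutionOfSingularities.ResolutionOfSingularities.Theorems.SigmaMaxModificationsCorridor3.TameLowSnc

end
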